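import Summits.AnomalousDissipation.AnomalousDissipation.Theorems.SawtoothPulseCascadeK1LocalisedCascadeCornerLayer

/-!
# K1loc, line `Spectral` / thin start — helper: THE DECAYING CORNER MAJORANT (constants lever, memo v9 §9 (b))

Helper file of the prover lane on the crux `K1LocalisedCascade` (stmt-AnomalousDissipation-19491), route
`SawtoothPulseCascade` (S-D fibre ledger).  `…CornerLayer` pays the mid-band part of the chirp with a FLAT tent on a layer as
wide as the kernel tail radius (`∫ρ² ∝ A²·A_tail·N/D`).  Since the exact-chirp bound of `…SawtoothChirp` holds at EVERY radius below
the phase distance and the trapezoid kernels decay like `1/(D‖s‖²)` (`…TrapezoidFejer`), the natural majorant DECAYS away from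
the corners: `ρ(b) = ε₀ + A·d₀/max(infDist(b, C_N), d₀)`.  This file proves its properties:
* `continuous_envelope`, `envelope_nonneg`, `envelope_eq_on_core` (`ρ = ε₀ + A` where `infDist ≤ d₀`),
  `envelope_ge_off_core` (`ρ ≥ ε₀ + A d₀/infDist` where `infDist ≥ d₀`);
* `decay_le_sum_over_corners` — `(d₀/max(infDist(b,C),d₀))² ≤ Σ_{c∈C} (d₀/max(‖b−c‖,d₀))²` (finite `C`);
* `integral_decay_sq_le` — `∫_T (d₀/max(‖b‖,d₀))² ≤ 2πd₀` (comparison with `2d₀²/(‖b‖²+d₀²)` and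
  `…AxisKernel.integral_inv_one_add_sq_norm_le`);
* `integral_envelope_sq_le` — **`∫_T ρ² ≤ 2ε₀² + 2A²·(2N)·2πd₀`**: LINEAR in the layer scale `d₀ ≍ 1/(DA)`, no tail-radius inflation.
No definitions; no statement about the crux. [folklore] [problem: turb]
-/

-- `Summit.<Summit>.<Problem>`: single-conjunct summit, the duplicate namespace segment is deliberate.
set_option linter.dupNamespace false

noncomputable section

namespace Summit.AnomalousDissipation.AnomalousDissipation.Theorems.SawtoothPulseCascade.K1Window

open MeasureTheory Set Filter Topology Function Metric
open scoped Real ENNReal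

/-! ## §1 The decay profile `d₀/max(r, d₀)` -/

/-- `0 ≤ d₀/max(r,d₀) ≤ 1` for `d₀ > 0`. [folklore] -/
theorem decay_nonneg_le_one {d₀ : ℝ} (hd : 0 < d₀) (r : ℝ) : 0 ≤ d₀ / max r d₀ ∧ d₀ / max r d₀ ≤ 1 := by
  have hm : 0 < max r d₀ := lt_max_of_lt_right hd
  exact ⟨div_nonneg hd.le hm.le, (div_le_one hm).mpr (le_max_right _ _)⟩

/-- The decay profile is antitone in `r`. [folklore] -/
theorem decay_antitone {d₀ : ℝ} (hd : 0 < d₀) {r r' : ℝ} (h : r ≤ r') : d₀ / max r' d₀ ≤ d₀ / max r d₀ :=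
  div_le_div_of_nonneg_left hd.le (lt_max_of_lt_right hd) (max_le_max h le_rfl)

/-- Comparison with a Cauchy profile: `(d₀/max(r,d₀))² ≤ 2d₀²·(d₀² + r²)⁻¹`. [folklore] -/
theorem decay_sq_le_cauchy {d₀ : ℝ} (hd : 0 < d₀) (r : ℝ) (hr : 0 ≤ r) :
    (d₀ / max r d₀) ^ 2 ≤ 2 * d₀ ^ 2 * (d₀ ^ 2 + r ^ 2)⁻¹ := by
  have hpos : 0 < d₀ ^ 2 + r ^ 2 := by positivity
  rw [div_pow, ← div_eq_mul_inv, div_le_div_iff₀ (by positivity) hpos]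
  by_cases h : r ≤ d₀
  · rw [max_eq_right h]
    have : r ^ 2 ≤ d₀ ^ 2 := pow_le_pow_left₀ hr h 2
    nlinarith [sq_nonneg d₀]
  · push Not at h
    rw [max_eq_left h.le]
    have : d₀ ^ 2 ≤ r ^ 2 := pow_le_pow_left₀ hd.le h.le 2
    nlinarith [sq_nonneg d₀]

/-- **`∫_T (d₀/max(‖b‖,d₀))² db ≤ 2πd₀`** (`d₀ > 0`). [folklore] -/
theorem integral_decay_sq_le {d₀ : ℝ} (hd : 0 < d₀) :
    ∫ b : UnitAddCircle, (d₀ / max ‖b‖ d₀) ^ 2 ≤ 2 * π * d₀ := by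
  have hI : ∀ {f : UnitAddCircle → ℝ}, Continuous f → Integrable f := fun hf =>
    hf.integrable_of_hasCompactSupport (HasCompactSupport.of_compactSpace _)
  have hc1 : Continuous fun b : UnitAddCircle => (d₀ / max ‖b‖ d₀) ^ 2 :=
    (continuous_const.div (continuous_norm.max continuous_const) fun b => (lt_max_of_lt_right hd).ne').pow 2
  have hwc : Continuous fun b : UnitAddCircle => 1 + (1 / d₀) ^ 2 * ‖b‖ ^ 2 :=
    continuous_const.add (continuous_const.mul (continuous_norm.pow 2))
  have hc2 : Continuous fun b : UnitAddCircle => 2 * (1 + (1 / d₀) ^ 2 * ‖b‖ ^ 2)⁻¹ := by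
    refine continuous_const.mul (hwc.inv₀ fun b => ?_)
    have : 0 ≤ (1 / d₀) ^ 2 * ‖b‖ ^ 2 := by positivity
    linarith
  have hpt : ∀ b : UnitAddCircle, (d₀ / max ‖b‖ d₀) ^ 2 ≤ 2 * (1 + (1 / d₀) ^ 2 * ‖b‖ ^ 2)⁻¹ := by
    intro b
    refine (decay_sq_le_cauchy hd ‖b‖ (norm_nonneg _)).trans (le_of_eq ?_)
    field_simp
  refine (integral_mono (hI hc1) (hI hc2) hpt).trans ?_
  rw [integral_const_mul]
  have h := integral_inv_one_add_sq_norm_le (Λ := 1 / d₀) (by positivity)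
  calc 2 * ∫ b : UnitAddCircle, (1 + (1 / d₀) ^ 2 * ‖b‖ ^ 2)⁻¹ ≤ 2 * (π / (1 / d₀)) :=
        mul_le_mul_of_nonneg_left h (by positivity)
    _ = 2 * π * d₀ := by field_simp

/-! ## §2 From the distance to a finite corner set to the distances to its points -/

/-- For a finite nonempty `C` the decay of `infDist(b, C)` is at most the SUM of the decays of the distances to the points
of `C`. [folklore] -/
theorem decay_sq_infDist_le_sum (d₀ : ℝ) (C : Finset UnitAddCircle) (hC : C.Nonempty) (b : UnitAddCircle) :
    (d₀ / max (infDist b (C : Set UnitAddCircle)) d₀) ^ 2 ≤ ∑ c ∈ C, (d₀ / max ‖b - c‖ d₀) ^ 2 := by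
  obtain ⟨c₀, hc₀, hdist⟩ := (C.finite_toSet.isCompact).exists_infDist_eq_dist (Finset.coe_nonempty.mpr hC) b
  rw [hdist, dist_eq_norm]
  exact Finset.single_le_sum (f := fun c => (d₀ / max ‖b - c‖ d₀) ^ 2) (fun c _ => sq_nonneg _) (by exact_mod_cast hc₀)

/-- **`∫_T (d₀/max(infDist(b,C),d₀))² ≤ |C|·2πd₀`** for a finite nonempty corner set `C`. [folklore] -/
theorem integral_decay_sq_infDist_le {d₀ : ℝ} (hd : 0 < d₀) (C : Finset UnitAddCircle) (hC : C.Nonempty) :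
    ∫ b : UnitAddCircle, (d₀ / max (infDist b (C : Set UnitAddCircle)) d₀) ^ 2 ≤ C.card * (2 * π * d₀) := by
  classical
  have hI : ∀ {f : UnitAddCircle → ℝ}, Continuous f → Integrable f := fun hf =>
    hf.integrable_of_hasCompactSupport (HasCompactSupport.of_compactSpace _)
  have hc1 : Continuous fun b : UnitAddCircle => (d₀ / max (infDist b (C : Set UnitAddCircle)) d₀) ^ 2 :=
    (continuous_const.div ((continuous_infDist_pt _).max continuous_const) fun b => (lt_max_of_lt_right hd).ne').pow 2
  have hcc : ∀ c : UnitAddCircle, Continuous fun b : UnitAddCircle => (d₀ / max ‖b - c‖ d₀) ^ 2 := fun c =>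
    (continuous_const.div ((continuous_norm.comp (continuous_id.sub continuous_const)).max continuous_const)
      fun b => (lt_max_of_lt_right hd).ne').pow 2
  refine (integral_mono (hI hc1) (integrable_finsetSum _ fun c _ => hI (hcc c)) (decay_sq_infDist_le_sum d₀ C hC)).trans ?_
  rw [integral_finsetSum _ fun c _ => hI (hcc c)]
  have heach : ∀ c ∈ C, ∫ b : UnitAddCircle, (d₀ / max ‖b - c‖ d₀) ^ 2 ≤ 2 * π * d₀ := by
    intro c _
    have htr := integral_sub_right_eq_self (μ := (volume : Measure UnitAddCircle)) (fun b : UnitAddCircle => (d₀ / max ‖b‖ d₀) ^ 2) c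
    rw [htr]
    exact integral_decay_sq_le hd
  calc ∑ c ∈ C, ∫ b : UnitAddCircle, (d₀ / max ‖b - c‖ d₀) ^ 2 ≤ ∑ c ∈ C, 2 * π * d₀ := Finset.sum_le_sum heach
    _ = C.card * (2 * π * d₀) := by rw [Finset.sum_const, nsmul_eq_mul]

/-! ## §3 The envelope majorant `ρ = ε₀ + A·d₀/max(infDist, d₀)` -/

/-- Continuity, nonnegativity and the two regimes of the envelope. [folklore] -/
theorem envelope_facts (C : Set UnitAddCircle) {ε₀ A d₀ : ℝ} (hε : 0 ≤ ε₀) (hA : 0 ≤ A) (hd : 0 < d₀) :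
    Continuous (fun b : UnitAddCircle => ε₀ + A * (d₀ / max (infDist b C) d₀)) ∧
    (∀ b, 0 ≤ ε₀ + A * (d₀ / max (infDist b C) d₀)) ∧
    (∀ b, infDist b C ≤ d₀ → ε₀ + A * (d₀ / max (infDist b C) d₀) = ε₀ + A) ∧
    (∀ b, d₀ ≤ infDist b C → ε₀ + A * (d₀ / max (infDist b C) d₀) = ε₀ + A * d₀ / infDist b C) := by
  refine ⟨continuous_const.add (continuous_const.mul (continuous_const.div ((continuous_infDist_pt _).max continuous_const)
    fun b => (lt_max_of_lt_right hd).ne')), fun b => ?_, fun b hb => ?_, fun b hb => ?_⟩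
  · have := (decay_nonneg_le_one hd (infDist b C)).1; positivity
  · rw [max_eq_right hb, div_self hd.ne', mul_one]
  · rw [max_eq_left hb, mul_div_assoc]

/-- **`L²` mass of the envelope**: `∫_T (ε₀ + A·d₀/max(infDist(b,C_N),d₀))² ≤ 2ε₀² + 2A²·|C_N|·2πd₀`. [folklore] -/
theorem integral_envelope_sq_le (C : Finset UnitAddCircle) (hC : C.Nonempty) {ε₀ A d₀ : ℝ} (hε : 0 ≤ ε₀) (hA : 0 ≤ A)
    (hd : 0 < d₀) :
    ∫ b : UnitAddCircle, (ε₀ + A * (d₀ / max (infDist b (C : Set UnitAddCircle)) d₀)) ^ 2 ≤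
      2 * ε₀ ^ 2 + 2 * A ^ 2 * (C.card * (2 * π * d₀)) := by
  have hI : ∀ {f : UnitAddCircle → ℝ}, Continuous f → Integrable f := fun hf =>
    hf.integrable_of_hasCompactSupport (HasCompactSupport.of_compactSpace _)
  obtain ⟨hρc, -, -, -⟩ := envelope_facts (C : Set UnitAddCircle) hε hA hd
  have hc1 : Continuous fun b : UnitAddCircle => (d₀ / max (infDist b (C : Set UnitAddCircle)) d₀) ^ 2 :=
    (continuous_const.div ((continuous_infDist_pt _).max continuous_const) fun b => (lt_max_of_lt_right hd).ne').pow 2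
  have hpt : ∀ b : UnitAddCircle, (ε₀ + A * (d₀ / max (infDist b (C : Set UnitAddCircle)) d₀)) ^ 2 ≤
      2 * ε₀ ^ 2 + 2 * A ^ 2 * (d₀ / max (infDist b (C : Set UnitAddCircle)) d₀) ^ 2 := by
    intro b
    nlinarith [sq_nonneg (ε₀ - A * (d₀ / max (infDist b (C : Set UnitAddCircle)) d₀))]
  have hI2 : Integrable (fun b : UnitAddCircle =>
      2 * ε₀ ^ 2 + 2 * A ^ 2 * (d₀ / max (infDist b (C : Set UnitAddCircle)) d₀) ^ 2) :=
    (integrable_const _).add ((hI hc1).const_mul _)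
  refine (integral_mono (hI (hρc.pow 2)) hI2 hpt).trans ?_
  rw [integral_add (integrable_const _) ((hI hc1).const_mul _), integral_const, integral_const_mul, probReal_univ,
    one_smul]
  have h := integral_decay_sq_infDist_le hd C hC
  nlinarith [sq_nonneg A]

end Summit.AnomalousDissipation.AnomalousDissipation.Theorems.SawtoothPulseCascade.K1Window
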